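import Literature.AlgebraicGeometry.HodgeTheory.HodgeGroupProductSemisimpleCMFactor
import HarnessLib

/-!
# Hodge classes on `A × C`, `C` of CM type — IV: the product cells of small dimension (`dim ≤ 7`): the rows on which the hypothesis HC_CM is ABSENT (CM factor of dimension `≤ 3`, or divisor-generated), per-cell exactness (a covered cell `A × C` is worth exactly the instance of HC_CM at `C`), and the first cell OUTSIDE the mechanism (Moonen–Zarhin 1999, case (a): a type-IV threefold times a CM elliptic curve)

Family `hodge`, layer `Literature/AlgebraicGeometry/HodgeTheory`. Written for the cell `pub-hodge-ring2`
(route seat `motiv`, generation 4: Mumford–Tate groups / Hodge-ring generation), serving the ATLAS of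
abelian varieties of dimension `≤ 7` (lead schema L3: one row per endomorphism/Mumford–Tate cell, with a
KIND column LOAD-BEARING / ABSENT / DISCHARGED / IS-THE-HYPOTHESIS for the hypothesis HC_CM). HONEST
FRAMING: research route conditional on HC_CM; not a corollary; Q11.4-sentence-2 already refuted in
dim ≥ 3. (No statement minted inside this programme is cited as a fact; the one new named fact below is a
theorem in print of Moonen–Zarhin, used only as a hypothesis.)

HC_CM := "the Hodge conjecture for every complex abelian variety of CM type", always the BINDER
`(hCM : ∀ B, Milne1999.CMHodgeHypothesisAt B)`; its instance at one `C` is `Milne1999.CMHodgeHypothesisAt C`.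

## What Parts I–III give (by name) and what this part adds

Parts I–III (`HodgeGroupProductCMFactor`, `…Classes`, `…SemisimpleCMFactor`) prove, modulo the printed
splitting fact `Gordon1999_hodgeClassesProductSpan_of_semisimple` ("`Hg(B)` a torus, `Hg(C)` semisimple
⟹ `Hg(B × C) = Hg(B) × Hg(C)`", Gordon 1999 §3 with Goursat 2.16 and Mumford 2.12; Moonen–Zarhin 1999
§3 (3.1)–(3.2); Lombardo 2016 Lemma 3.4 for "no type-IV factor"): for `A` with SEMISIMPLE Hodge group
(`HasSemisimpleHodgeGroup A`) and `C` of CM type,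
`HC(A × C) ⟺ HC(A) ∧ HC(C)` (`hodgeConjectureFor_prod_iff_of_gordon`), hence `HC_CM ∧ HC(A) ⟹ HC(A × C)`.

This part reads that exactness CELL BY CELL, as the atlas needs it:

* KIND = ABSENT. If the CM factor `C` has dimension `≤ 3` (HC(`C`) is the tree's unconditional
  `hodgeConjectureFor_of_dim_le_three_holds`) or is divisor-generated (`IsDivisorGenerated C`: Lefschetz
  (1,1) + cup products, `hodgeConjectureFor_of_isDivisorGenerated`), then HC(`A × C`) follows from HC(`A`)
  and the splitting fact ALONE — HC_CM is not used:
  `hodgeConjectureFor_prod_of_semisimple_of_cm_dim_le_three`, `…_of_lombardo_of_cm_dim_le_three`,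
  `…_of_semisimple_of_isDivisorGenerated_cm`; with `dim A ≤ 3` as well the cell is closed outright modulo
  the splitting fact (`…_of_dim_le_three_of_cm_dim_le_three`, all cells `A × C` with `dim A, dim C ≤ 3`,
  `A` with semisimple Hodge group / without type-IV factor, `C` CM — total dimension `≤ 6`); with
  `dim A ≤ 5` on Markman's claim (`…_of_dim_le_five_of_cm_dim_le_three_of`, e.g. a general Weil-type
  fourfold times a CM threefold, dimension 7).
* KIND = LOAD-BEARING, and exactly how much: for `A` with semisimple Hodge group satisfying HC and `C` of
  CM type, `HC(A × C) ⟺ Milne1999.CMHodgeHypothesisAt C`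
  (`hodgeConjectureFor_prod_iff_cmHodgeHypothesisAt_of_semisimple`): the cell is worth EXACTLY the
  instance of HC_CM at its own CM factor — no more (it does not reach HC_CM at any other CM variety), no
  less (HC(`A × C`) restricted to the slice `{0} × C` is HC(`C`)). In dimension `≤ 7` this is load-bearing
  precisely when `C` (of dimension `4 ≤ dim C ≤ 6`) carries exceptional Hodge classes: by Moonen–Zarhin
  1999 Thm. (0.1)/(0.2) read on CM varieties, for `dim C = 4` iff `C ~ E_k × Y` with `Y` a simple CM
  threefold whose CM field contains the imaginary quadratic field `k` (case (a)), or `C` simple with CM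
  field containing an imaginary quadratic `k` acting with multiplicities `(2,2)` (case (b)); for
  `dim C = 5` iff `C` contains such a fourfold pattern (cases (e), (f), and `E' × Y₄` with `Y₄` of case
  (b)); otherwise `B(C) = D(C)` and the cell is ABSENT via `IsDivisorGenerated C`.
* THE BOUNDARY of the mechanism on the non-CM side, by name: Moonen–Zarhin's case (a) with a NON-CM
  threefold — `X ~ Y × E`, `E` an elliptic curve with CM by `k`, `Y` a simple abelian threefold with
  `k ↪ End⁰(Y)` (type IV(1,1), `k` acting with multiplicities `(2,1)`; the general such `Y` has
  `End⁰(Y) = k`, `Hg(Y)` a unitary group of signature `(2,1)`, not of CM type) — has Weil classes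
  `W_k ⊂ H¹(E) ⊗ H³(Y)` that are Hodge but not products of Hodge classes of the factors ("in the cases (a),
  (b) and (c) the Weil classes are really needed to generate the Hodge ring; `D²(X) ≠ B²(X)`"). Vendored
  as the existence fact `MoonenZarhin1999_exists_typeIV_threefold_prod_cmCurve_not_productSpan`; its
  consequences here: a non-CM threefold whose Hodge group is not semisimple / which has a type-IV factor
  exists (granted the splitting facts), and the hypothesis "semisimple Hodge group" in the `dim ≤ 3` rows
  CANNOT be dropped (`not_forall_prod_dim_le_three_productSpan_of`) — although HC itself is known for both
  factors. Such cells (an unbalanced type-IV factor of `A` sharing an imaginary quadratic field with the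
  CM factor) are NOT reached through the CM factor; they belong to the Weil-type programme (Markman's
  claim in dimension 4; open in general).

## What is NOT here (honest)

* No new case of the Hodge conjecture for a non-CM variety is proved; every row is glue over the printed
  splitting fact(s), the tree's `dim ≤ 3` theorem, Lefschetz (1,1), and (one row) Markman's claim.
* `HasSemisimpleHodgeGroup` of a product / power / isogenous variety is not computed on carriers (stays a
  hypothesis where needed, as in Part III); the criterion "a simple type-IV factor has semisimple Hodge
  group iff its centre field acts on the tangent space with equal multiplicities `n_σ = n_σ̄`"
  (Moonen–Zarhin §1 with (1.9)) is recorded in the cell's map, not typed.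
* HC_CM is a binder wherever it occurs; nothing here bears on HC_CM itself.

## References

* [MoonenZarhin1999LowDim] B. Moonen, Yu. Zarhin, *Hodge classes on abelian varieties of low dimension*,
  Math. Ann. 315 (1999) 711–733 [arXiv:math/9901113]: Introduction (0.1)–(0.2) and the sentence after
  (0.1)(4); §2 (2.3)–(2.4); §3 (3.1)–(3.2), (3.6), (3.8); §5 (5.3).
* [Gordon1999HodgeAVSurvey] B. B. Gordon, *A survey of the Hodge conjecture for abelian varieties*
  (Appendix B to Lewis' Survey, 2nd ed., 1999) [arXiv:alg-geom/9709030]: 1.3, 2.12, 2.16, §3.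
* [Lombardo2016] D. Lombardo, Lemma 3.4. [vanGeemen1994HodgeAV] B. van Geemen, LNM 1594, 4.9–4.13.
* [Markman2025SurveySecant] E. Markman (claim, under review). [Milne1999] J. S. Milne, §7 (HC_CM).
-/

noncomputable section

open CategoryTheory MonoidalCategory CartesianMonoidalCategory
open Literature.AlgebraicTopology.SingularHomology

namespace Literature.AlgebraicGeometry.HodgeTheory

section HodgeTheory

/-! ### KIND = ABSENT: the CM factor has dimension `≤ 3` or is divisor-generated (HC_CM not used) -/

/-- **CM factor of dimension `≤ 3` — no HC_CM.** For `A` with semisimple Hodge group satisfying HC and `C`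
of CM type of dimension `≤ 3`, HC holds for `A × C`, modulo the printed splitting fact only: HC(`C`) is
the tree's unconditional `dim ≤ 3` theorem, and the Hodge classes of `A × C` are spanned by products.
[cite: Gordon1999HodgeAVSurvey, §3 proof of the Theorem (last step)] [cite: MoonenZarhin1999LowDim, §3 (3.1)–(3.2)] -/
theorem hodgeConjectureFor_prod_of_semisimple_of_cm_dim_le_three
    (hG : Gordon1999_hodgeClassesProductSpan_of_semisimple) (A C : Motives.AbelianVariety ℂ)
    (hA : HasSemisimpleHodgeGroup A) (hCt : Milne1999.IsOfCMType C) (hC3 : C.dim ≤ 3)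
    (hHA : HodgeConjectureFor A.dim A.X) : HodgeConjectureFor (A.prod C).dim (A.prod C).X :=
  hodgeConjectureFor_prod_of_productSpan A C (hG A C hA hCt) hHA
    (hodgeConjectureFor_of_dim_le_three_holds hC3 Motives.AbelianVariety.isSmoothProjective_holds)

/-- **CM factor of dimension `≤ 3`, `A` without type-IV factor (Lombardo's hypothesis) — no HC_CM.**
[cite: Lombardo2016, Lemma 3.4] [cite: MoonenZarhin1999LowDim, §3 (3.1)] -/
theorem hodgeConjectureFor_prod_of_lombardo_of_cm_dim_le_three
    (hL : Lombardo2016_hodgeClassesProductSpan) (A C : Motives.AbelianVariety ℂ)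
    (hA4 : HasNoTypeIVFactor A) (hCt : Milne1999.IsOfCMType C) (hC3 : C.dim ≤ 3)
    (hHA : HodgeConjectureFor A.dim A.X) : HodgeConjectureFor (A.prod C).dim (A.prod C).X :=
  hodgeConjectureFor_prod_of_productSpan A C (hL A C hA4 hCt) hHA
    (hodgeConjectureFor_of_dim_le_three_holds hC3 Motives.AbelianVariety.isSmoothProjective_holds)

/-- **Both factors of dimension `≤ 3` (total dimension `≤ 6`), `A` with semisimple Hodge group, `C` of CM
type — closed outright modulo the splitting fact**: no HC_CM, no claim. (The hypothesis on `Hg(A)` cannot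
be dropped: `not_forall_prod_dim_le_three_productSpan_of` below.)
[cite: Gordon1999HodgeAVSurvey, §3 proof of the Theorem (last step)] [cite: MoonenZarhin1999LowDim, §3 (3.2)] -/
theorem hodgeConjectureFor_prod_of_semisimple_of_dim_le_three_of_cm_dim_le_three
    (hG : Gordon1999_hodgeClassesProductSpan_of_semisimple) (A C : Motives.AbelianVariety ℂ)
    (hA : HasSemisimpleHodgeGroup A) (hA3 : A.dim ≤ 3) (hCt : Milne1999.IsOfCMType C)
    (hC3 : C.dim ≤ 3) : HodgeConjectureFor (A.prod C).dim (A.prod C).X :=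
  hodgeConjectureFor_prod_of_semisimple_of_cm_dim_le_three hG A C hA hCt hC3
    (hodgeConjectureFor_of_dim_le_three_holds hA3 Motives.AbelianVariety.isSmoothProjective_holds)

/-- **Both factors of dimension `≤ 3`, `A` without type-IV factor, `C` of CM type — closed outright modulo
Lombardo's splitting fact.** [cite: Lombardo2016, Lemma 3.4] [cite: MoonenZarhin1999LowDim, §3 (3.2)] -/
theorem hodgeConjectureFor_prod_of_lombardo_of_dim_le_three_of_cm_dim_le_three
    (hL : Lombardo2016_hodgeClassesProductSpan) (A C : Motives.AbelianVariety ℂ)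
    (hA4 : HasNoTypeIVFactor A) (hA3 : A.dim ≤ 3) (hCt : Milne1999.IsOfCMType C) (hC3 : C.dim ≤ 3) :
    HodgeConjectureFor (A.prod C).dim (A.prod C).X :=
  hodgeConjectureFor_prod_of_lombardo_of_cm_dim_le_three hL A C hA4 hCt hC3
    (hodgeConjectureFor_of_dim_le_three_holds hA3 Motives.AbelianVariety.isSmoothProjective_holds)

/-- **Divisor-generated CM factor (the NONDEGENERATE CM cells: `B(C) = D(C)`) — no HC_CM.** For `A` with
semisimple Hodge group satisfying HC and `C` of CM type whose rational Hodge classes are spanned by cup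
products of divisor classes, HC holds for `A × C` modulo the splitting fact only. In dimension `≤ 7` this
is every CM factor `C` of dimension `4` or `5` outside Moonen–Zarhin's cases (a), (b), (e), (f) (and
`E' × Y₄`, `Y₄` of case (b)), by their Thm. (0.1)(4)/(0.2)(4) read on CM varieties.
[cite: MoonenZarhin1999LowDim, Introduction (0.1)(4), (0.2)(4)] [cite: Gordon1999HodgeAVSurvey, §3] -/
theorem hodgeConjectureFor_prod_of_semisimple_of_isDivisorGenerated_cm
    (hG : Gordon1999_hodgeClassesProductSpan_of_semisimple) (A C : Motives.AbelianVariety ℂ)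
    (hA : HasSemisimpleHodgeGroup A) (hCt : Milne1999.IsOfCMType C) (hCD : IsDivisorGenerated C)
    (hHA : HodgeConjectureFor A.dim A.X) : HodgeConjectureFor (A.prod C).dim (A.prod C).X :=
  hodgeConjectureFor_prod_of_productSpan A C (hG A C hA hCt) hHA
    (hodgeConjectureFor_of_isDivisorGenerated C hCD)

/-- **`dim A ≤ 5` on Markman's claim, CM factor of dimension `≤ 3` — no HC_CM** (e.g. a general abelian
fourfold of Weil type, `Hg = SU(2,2)` semisimple, times a CM threefold: dimension 7). The claim is a
binder, flagged under review. [claim: Markman2025SurveySecant, status: under-review]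
[cite: Gordon1999HodgeAVSurvey, §3 proof of the Theorem (last step)] -/
theorem hodgeConjectureFor_prod_of_semisimple_of_dim_le_five_of_cm_dim_le_three_of
    (hM : Markman2025_hodgeClasses_algebraic_abelian_dim_le_five)
    (hG : Gordon1999_hodgeClassesProductSpan_of_semisimple) (A C : Motives.AbelianVariety ℂ)
    (hd : A.dim ≤ 5) (hA : HasSemisimpleHodgeGroup A) (hCt : Milne1999.IsOfCMType C)
    (hC3 : C.dim ≤ 3) : HodgeConjectureFor (A.prod C).dim (A.prod C).X :=
  hodgeConjectureFor_prod_of_semisimple_of_cm_dim_le_three hG A C hA hCt hC3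
    (hodgeConjectureFor_abelian_of_dim_le_five_of hM A nonempty_hodgeModel_holds hd
      Motives.AbelianVariety.isSmoothProjective_holds)

/-- **Isogeny closure of the `dim C ≤ 3` row** (the atlas cells are isogeny classes `X ~ A × C`).
[cite: Gordon1999HodgeAVSurvey, §3] [cite: MoonenZarhin1999LowDim, §3 (3.2)] -/
theorem hodgeConjectureFor_of_isIsogenous_prod_of_semisimple_of_cm_dim_le_three
    (hG : Gordon1999_hodgeClassesProductSpan_of_semisimple) {X : Motives.AbelianVariety ℂ}
    (A C : Motives.AbelianVariety ℂ) (hX : Motives.AbelianVariety.IsIsogenous X (A.prod C))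
    (hA : HasSemisimpleHodgeGroup A) (hCt : Milne1999.IsOfCMType C) (hC3 : C.dim ≤ 3)
    (hHA : HodgeConjectureFor A.dim A.X) : HodgeConjectureFor X.dim X.X :=
  HodgeConjectureFor.of_isIsogenous hX
    (hodgeConjectureFor_prod_of_semisimple_of_cm_dim_le_three hG A C hA hCt hC3 hHA)

/-! ### KIND = LOAD-BEARING, exactly: the cell `A × C` is worth the instance of HC_CM at `C` -/

/-- **Per-cell exactness.** For `A` with semisimple Hodge group satisfying HC and `C` of CM type, the Hodge
conjecture for `A × C` is EQUIVALENT to the instance `Milne1999.CMHodgeHypothesisAt C` of HC_CM at the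
cell's own CM factor (modulo the splitting fact): (→) restrict to the slice `{0} × C`; (←) products of
algebraic classes. So a covered cell neither needs nor yields HC_CM at any other CM variety.
[cite: Gordon1999HodgeAVSurvey, §3 proof of the Theorem (last step)] [cite: Milne1999, §7 p. 72] -/
theorem hodgeConjectureFor_prod_iff_cmHodgeHypothesisAt_of_semisimple
    (hG : Gordon1999_hodgeClassesProductSpan_of_semisimple) (A C : Motives.AbelianVariety ℂ)
    (hA : HasSemisimpleHodgeGroup A) (hCt : Milne1999.IsOfCMType C)
    (hHA : HodgeConjectureFor A.dim A.X) :
    HodgeConjectureFor (A.prod C).dim (A.prod C).X ↔ Milne1999.CMHodgeHypothesisAt C :=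
  ⟨cmHodgeHypothesisAt_of_hodgeConjectureFor_prod A C, fun hC ↦
    hodgeConjectureFor_prod_of_productSpan A C (hG A C hA hCt) hHA
      (hC Motives.AbelianVariety.isSmoothProjective_holds hCt)⟩

/-- **Per-cell exactness, plain form**: `HC(A × C) ⟺ HC(C)` for `A` with semisimple Hodge group
satisfying HC and `C` of CM type. [cite: Gordon1999HodgeAVSurvey, §3 proof of the Theorem (last step)] -/
theorem hodgeConjectureFor_prod_iff_cm_of_semisimple
    (hG : Gordon1999_hodgeClassesProductSpan_of_semisimple) (A C : Motives.AbelianVariety ℂ)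
    (hA : HasSemisimpleHodgeGroup A) (hCt : Milne1999.IsOfCMType C)
    (hHA : HodgeConjectureFor A.dim A.X) :
    HodgeConjectureFor (A.prod C).dim (A.prod C).X ↔ HodgeConjectureFor C.dim C.X :=
  ⟨hodgeConjectureFor_right_of_prod A C, fun hC ↦
    hodgeConjectureFor_prod_of_productSpan A C (hG A C hA hCt) hHA hC⟩

/-- **The LOAD-BEARING cell through the single instance**: HC for `A × C` from HC(`A`) and the instance of
HC_CM at `C` only (not the blanket binder). [cite: Gordon1999HodgeAVSurvey, §3] [cite: Milne1999, §7 p. 72] -/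
theorem hodgeConjectureFor_prod_of_semisimple_of_cmHodgeHypothesisAt
    (hG : Gordon1999_hodgeClassesProductSpan_of_semisimple) (A C : Motives.AbelianVariety ℂ)
    (hA : HasSemisimpleHodgeGroup A) (hCt : Milne1999.IsOfCMType C)
    (hHA : HodgeConjectureFor A.dim A.X) (hC : Milne1999.CMHodgeHypothesisAt C) :
    HodgeConjectureFor (A.prod C).dim (A.prod C).X :=
  (hodgeConjectureFor_prod_iff_cmHodgeHypothesisAt_of_semisimple hG A C hA hCt hHA).2 hC

/-! ### The boundary of the mechanism: Moonen–Zarhin's case (a) with a non-CM threefold -/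

/-- **Moonen–Zarhin 1999, Thm. (0.1)(1) with case (a) and the remark after (0.1)(4), §2 (2.3)–(2.4), §5
(5.3)**: there exist a complex abelian threefold `A` NOT of CM type and an elliptic curve `C` with complex
multiplication such that the rational Hodge classes of `A × C` are not spanned by exterior products of
Hodge classes of the factors. (Take `A` simple of type IV(1,1): `End⁰(A) = k` imaginary quadratic acting
on the tangent space with multiplicities `(2,1)` — the general member of the corresponding family, `Hg(A)` a
unitary group of signature `(2,1)`, is not of CM type — and `C` with CM by the same `k`: then `k` acts on
`A × C` with multiplicities `(2,2)`, the space of Weil classes `W_k = ∧⁴_k H¹ ⊂ H¹(C) ⊗ H³(A)` consists of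
Hodge classes, "the Weil classes are really needed to generate the Hodge ring; `D²(X) ≠ B²(X)`", and a
class with a nonzero odd ⊗ odd Künneth component is not in the span of products of even-degree classes.)
A theorem in print about Hodge structures of abelian varieties, vendored as a named existence fact and
used only as a hypothesis; it is tightness information (the non-CM analogue of Shioda's CM × CM pairs,
`Shioda1981_exists_cmType_prod_not_productSpan`), not a step towards any target.
[cite: MoonenZarhin1999LowDim, Introduction (0.1)(1) and the remark after (0.1)(4); §2 (2.4); §5 (5.3)]
[cite: vanGeemen1994HodgeAV, 4.9–4.13] -/
def MoonenZarhin1999_exists_typeIV_threefold_prod_cmCurve_not_productSpan : Prop :=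
  ∃ (A C : Motives.AbelianVariety ℂ), A.dim = 3 ∧ ¬ Milne1999.IsOfCMType A ∧ C.dim = 1 ∧
    Milne1999.IsOfCMType C ∧ ¬ HodgeClassesProductSpan A C

/-- **A non-CM threefold whose Hodge group is not semisimple exists** (granted Gordon's splitting fact and
Moonen–Zarhin's case (a)): `HasSemisimpleHodgeGroup` is a genuine restriction beyond "not of CM type",
already in dimension 3 (the type-IV(1,1) threefolds: central torus `U_k` in `Hg`).
[cite: MoonenZarhin1999LowDim, §2 (2.4)(3)] [cite: Gordon1999HodgeAVSurvey, §3] -/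
theorem exists_dim_three_not_cmType_not_hasSemisimpleHodgeGroup_of
    (hG : Gordon1999_hodgeClassesProductSpan_of_semisimple)
    (hN : MoonenZarhin1999_exists_typeIV_threefold_prod_cmCurve_not_productSpan) :
    ∃ A : Motives.AbelianVariety ℂ, A.dim = 3 ∧ ¬ Milne1999.IsOfCMType A ∧ ¬ HasSemisimpleHodgeGroup A := by
  obtain ⟨A, C, hA3, hAn, -, hCt, hns⟩ := hN
  exact ⟨A, hA3, hAn, fun hss ↦ hns (hG A C hss hCt)⟩

/-- **A non-CM threefold with a type-IV factor exists** (granted Lombardo's splitting fact and Moonen–Zarhin's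
case (a)): the endomorphism-side hypothesis `HasNoTypeIVFactor` is a genuine restriction in dimension 3.
[cite: MoonenZarhin1999LowDim, §2 (2.3)–(2.4)] [cite: Lombardo2016, Lemma 3.4] -/
theorem exists_dim_three_not_cmType_not_hasNoTypeIVFactor_of
    (hL : Lombardo2016_hodgeClassesProductSpan)
    (hN : MoonenZarhin1999_exists_typeIV_threefold_prod_cmCurve_not_productSpan) :
    ∃ A : Motives.AbelianVariety ℂ, A.dim = 3 ∧ ¬ Milne1999.IsOfCMType A ∧ ¬ HasNoTypeIVFactor A := by
  obtain ⟨A, C, hA3, hAn, -, hCt, hns⟩ := hN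
  exact ⟨A, hA3, hAn, fun h4 ↦ hns (hL A C h4 hCt)⟩

/-- **The Hodge-group hypothesis of the `dim ≤ 3` rows cannot be dropped**: it is NOT true that for all
`A` of dimension `≤ 3` and all CM `C` of dimension `≤ 3` the Hodge classes of `A × C` are spanned by
products (Moonen–Zarhin's case (a)) — although HC holds for both factors unconditionally. Such cells are
outside the CM-factor mechanism. [cite: MoonenZarhin1999LowDim, Introduction (0.1)(1), case (a)] -/
theorem not_forall_prod_dim_le_three_productSpan_of
    (hN : MoonenZarhin1999_exists_typeIV_threefold_prod_cmCurve_not_productSpan) :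
    ¬ ∀ (A C : Motives.AbelianVariety ℂ), A.dim ≤ 3 → Milne1999.IsOfCMType C → C.dim ≤ 3 →
      HodgeClassesProductSpan A C := by
  obtain ⟨A, C, hA3, -, hC1, hCt, hns⟩ := hN
  exact fun h ↦ hns (h A C hA3.le hCt (by omega))

/-! ### On path

Every target of this file is `HodgeConjectureFor` of a complex abelian variety (or an equivalence between
such), so the Hodge conjecture for all smooth projective complex varieties gives each conclusion — by name,
Part I's `hodgeConjectureFor_prod_of_hodgeConjecture` (for `A × C`) and Part III's
`hodgeConjectureFor_of_hodgeConjecture'`; the existence fact above is tightness information only. -/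

end HodgeTheory

end Literature.AlgebraicGeometry.HodgeTheory

end
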